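import Mathlib
import HarnessLib
import Summits.AtomisticToContinuum.FouriersLaw.Theses.HoelderEscapeProfile
import Summits.AtomisticToContinuum.FouriersLaw.Theorems.JunctionLocalityConductanceLowerBoundStubBulkAbelFloorOfHeatVarianceBets

/-!
# Crux `AbelThermodynamicLimit` (stmt-AtomisticToContinuum-12596) on the bet route HoelderEscapeProfile:
# the route's ENGINE discharges the child CLB (stmt-11749), hence the crux and `FouriersLaw` follow from the engine + (R) alone

Support file (`--supports stmt-AtomisticToContinuum-12596`; closes nothing).  Lead seat 12596-c22, 2026-08-17.

On route HoelderEscapeProfile the deciding theorem `closes` builds, from the six ENGINE/frame cruxes `LocalEnergyHalfHoelder` (K1),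
`CornerNoDip` (K2), `AbelSpreadCeiling`, `AbelRegularity`, `FibreCalculus`, `SymmetricSetup`, an Abelian Green–Kubo witness
`(μ_T, D, κ)` — and that witness is SHIFT-INVARIANT (`SymmetricSetup`'s `μ_T`; `closes` binds `hSI` and drops it).  This file records:

* `regularAbelWitness_of_engine` — engine ⇒ for every `T > 0` a shift-invariant DLR state `μ_T`, a `μ_T`-preserving dynamics with
  absolutely convergent correlations and `κ > 0` with `T⁻²∫₀^∞e^{−νt}C_T → κ` as `ν ↓ 0` (the engine block of `closes`, verbatim,
  keeping `hSI`: pigeonhole in `k`, corner bound `A(ν) ≥ χ³/(512π²C'²)`, Helfand–Abel ceiling, Abelian dichotomy).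
* `bulkAbelFloor_of_engine` — hence a BULK ABEL FLOOR witness (`a = T²κ/2`).
* `conductanceLowerBound_of_engine` — hence, by the landed bridges of line `abel-floor-exchange` (p156938:
  `abelFloor_openChain_of_bulkWitness`, `slowRegularity_signed_of_uniformAbelianRegularity`,
  `conductanceLowerBound_of_abelFloor_and_signedSlowRegularity`), engine ∧ (R) ⇒ `HoelderEscapeProfile.ConductanceLowerBound`:
  on this route the split child CLB = stmt-11749 carries NO content beyond the engine and the sibling (R) = stmt-13416.
* `abelThermodynamicLimit_of_engine_and_regularity` — engine ∧ (R) ⇒ the crux (split glue p127832).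
* `fouriersLaw_of_engine_and_regularity` — engine ∧ (R) ⇒ `FouriersLaw` (through the route's own `closes`): the honest open cone of
  this node on the bet route is {stmt-13416} — CLB and the γ-blind crux hypothesis are both dispensable here, with NO restatement.

References: Helfand 1960; Kundu–Dhar–Narayan 2009; Bonetto–Lebowitz–Rey-Bellet 2000 §7.  No definitions, no named facts, no sorry.
-/

noncomputable section

open MeasureTheory Filter Set Topology
open scoped Topology
open Literature.MathematicalPhysics.KineticTheory.HeatConduction
open Summit.AtomisticToContinuum.FouriersLaw.Theses.HoelderEscapeProfile

namespace Summit.AtomisticToContinuum.FouriersLaw.Theorems.AbelThermodynamicLimit.HoelderEngine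

/-- **The corner lemma of `closes` (verbatim, isolated):** pigeonhole in `k` + the ½-Hölder on-site return + no corner dip give the
floor `A(ν) ≥ χ³/(512π²C'²)` eventually; the Helfand–Abel identity and the spread ceiling give `A(ν) ≤ |B|/2 + |M₀|/2`; the Abelian
dichotomy then forces a finite positive limit. [cite: Helfand1960, eq. (3.10)] -/
theorem corner : ∀ (A Ψ M χk : ℝ → ℝ) (fh Gh : ℝ → ℝ → ℝ) (M₀ C ν₀ B ν₁ : ℝ),
      0 < χk 0 → ContinuousAt χk 0 → (∀ ν, 0 < ν → Continuous (fh ν)) →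
      (∀ ν, 0 < ν → fh ν 0 = χk 0) → (∀ ν, 0 < ν → ∀ k, 0 ≤ fh ν k) →
      (∀ ν, 0 < ν → ∫ k in (-Real.pi)..Real.pi, fh ν k = 2 * Real.pi * Ψ ν) →
      0 < ν₀ → (∀ ν, 0 < ν → ν ≤ ν₀ → Ψ ν ≤ C * Real.sqrt ν) →
      (∀ ν, 0 < ν → ∀ k, χk k - fh ν k = (2 - 2 * Real.cos k) * Gh ν k / ν) →
      (∀ ν, 0 < ν → A ν = Gh ν 0) →
      (∀ a : ℝ, 0 < a → ∀ ε : ℝ, 0 < ε → ∃ ν₂ : ℝ, 0 < ν₂ ∧ ∀ ν, 0 < ν → ν ≤ ν₂ →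
        ∀ k, |k| ≤ a * Real.sqrt ν → Gh ν k ≤ Gh ν 0 + ε) →
      (∀ ν, 0 < ν → A ν = ν / 2 * (M ν - M₀)) →
      0 < ν₁ → (∀ ν, 0 < ν → ν ≤ ν₁ → M ν ≤ B / ν) →
      ((∃ L, Tendsto A (𝓝[>] 0) (𝓝 L)) ∨ Tendsto A (𝓝[>] 0) atTop) →
      ∃ κ₀, 0 < κ₀ ∧ Tendsto A (𝓝[>] 0) (𝓝 κ₀) := by
  intro A Ψ M χk fh Gh M₀ C ν₀ B ν₁ hχ hχc hfc hf0 hfn hfi hν₀ hK1 hid hA hND hH hν₁ hSC hreg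
  set χ := χk 0 with hχdef
  have hup : ∀ ν, 0 < ν → ν ≤ ν₁ → ν ≤ 1 → A ν ≤ |B| / 2 + |M₀| / 2 := by
    intro ν hν h1 h2
    rw [hH ν hν]
    have h3 : ν / 2 * M ν ≤ B / 2 :=
      calc ν / 2 * M ν ≤ ν / 2 * (B / ν) := mul_le_mul_of_nonneg_left (hSC ν hν h1) (by positivity)
        _ = B / 2 := by field_simp
    have h4 : |ν / 2 * M₀| ≤ |M₀| / 2 := by
      rw [abs_mul, abs_of_pos (by positivity : (0:ℝ) < ν / 2)]; nlinarith [abs_nonneg M₀]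
    linarith [le_abs_self B, neg_abs_le (ν / 2 * M₀), mul_sub (ν / 2) (M ν) M₀]
  set C' := max C 1 with hC'
  have hC'p : 0 < C' := lt_of_lt_of_le one_pos (le_max_right _ _)
  set a := 8 * Real.pi * C' / χ with ha
  have hap : 0 < a := by positivity
  set c₁ := χ ^ 3 / (512 * Real.pi ^ 2 * C' ^ 2) with hc₁
  have hc₁p : 0 < c₁ := by positivity
  obtain ⟨ν₂, hν₂, hND'⟩ := hND a hap c₁ hc₁p
  obtain ⟨δ, hδ, hδχ⟩ : ∃ δ > 0, ∀ k, |k| < δ → |χk k - χ| < χ / 4 := by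
    obtain ⟨δ, hδ, h⟩ := Metric.continuousAt_iff.mp hχc (χ / 4) (by positivity)
    exact ⟨δ, hδ, fun k hk => by simpa [Real.dist_eq] using h (by simpa [Real.dist_eq] using hk)⟩
  have hlow : ∀ ν, 0 < ν → ν ≤ ν₀ → ν ≤ ν₂ → a * Real.sqrt ν < δ → a * Real.sqrt ν ≤ Real.pi →
      c₁ ≤ A ν := by
    intro ν hν h0 h2 hKδ hKπ
    set K := a * Real.sqrt ν with hK
    have hsq : 0 < Real.sqrt ν := Real.sqrt_pos.mpr hν
    have hKp : 0 < K := mul_pos hap hsq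
    have hΨ : Ψ ν ≤ C' * Real.sqrt ν := (hK1 ν hν h0).trans (mul_le_mul_of_nonneg_right (le_max_left _ _) hsq.le)
    obtain ⟨k, ⟨hk0, hkK⟩, hfk⟩ : ∃ k ∈ Ioc (0:ℝ) K, fh ν k ≤ χ / 2 := by
      by_contra H
      push Not at H
      have hge : ∀ k ∈ Icc (0:ℝ) K, χ / 2 ≤ fh ν k := fun k hk => by
        rcases eq_or_lt_of_le hk.1 with h | h
        · rw [← h, hf0 ν hν]; linarith
        · exact (H k ⟨h, hk.2⟩).le
      have h1 : ∫ k in (0:ℝ)..K, (χ / 2 : ℝ) ≤ ∫ k in (0:ℝ)..K, fh ν k :=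
        intervalIntegral.integral_mono_on hKp.le (by simp) ((hfc ν hν).intervalIntegrable _ _) hge
      rw [intervalIntegral.integral_const, smul_eq_mul, sub_zero] at h1
      have h2 : ∫ k in (0:ℝ)..K, fh ν k ≤ ∫ k in (-Real.pi)..Real.pi, fh ν k :=
        intervalIntegral.integral_mono_interval (neg_nonpos.mpr Real.pi_pos.le) hKp.le hKπ
          (Eventually.of_forall fun k => hfn ν hν k) ((hfc ν hν).intervalIntegrable _ _)
      rw [hfi ν hν] at h2
      have h3 : K * (χ / 2) = 4 * Real.pi * C' * Real.sqrt ν := by rw [hK, ha]; field_simp; ring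
      have h4 : 0 < Real.pi * C' * Real.sqrt ν := by positivity
      nlinarith [h1, h2, hΨ, Real.pi_pos]
    have hc1 : Real.cos k < 1 := by
      have := Real.cos_lt_cos_of_nonneg_of_le_pi le_rfl (hkK.trans hKπ) hk0; rwa [Real.cos_zero] at this
    set d := 2 - 2 * Real.cos k with hd
    have hdp : 0 < d := by rw [hd]; linarith
    have hdk : d ≤ a ^ 2 * ν := by
      have e1 := Real.one_sub_sq_div_two_le_cos (x := k)
      have e2 : k ^ 2 ≤ K ^ 2 := pow_le_pow_left₀ hk0.le hkK 2
      rw [hK, mul_pow, Real.sq_sqrt hν.le] at e2; rw [hd]; linarith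
    have hχk : 3 * χ / 4 ≤ χk k := by
      have := hδχ k (by rw [abs_of_pos hk0]; exact lt_of_le_of_lt hkK hKδ)
      rw [abs_lt] at this; linarith [this.1]
    have hpr : χ / 4 * ν ≤ d * Gh ν k := by
      have e : (χk k - fh ν k) * ν = d * Gh ν k := by rw [hid ν hν k, hd]; field_simp
      rw [← e]; exact mul_le_mul_of_nonneg_right (by linarith) hν.le
    have hG2 : 2 * c₁ ≤ Gh ν k := by
      have e1 : Gh ν k = d * Gh ν k / d := by field_simp
      have e2 : χ / 4 * ν / d ≤ d * Gh ν k / d := div_le_div_of_nonneg_right hpr hdp.le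
      have e3 : χ / 4 * ν / (a ^ 2 * ν) ≤ χ / 4 * ν / d := div_le_div_of_nonneg_left (by positivity) hdp hdk
      have e4 : χ / 4 * ν / (a ^ 2 * ν) = 2 * c₁ := by rw [ha, hc₁]; field_simp; ring
      linarith
    have := hND' ν hν h2 k (by rw [abs_of_pos hk0]; exact hkK)
    rw [hA ν hν]; linarith
  have hpos : ∀ᶠ ν in 𝓝[>] (0:ℝ), 0 < ν := eventually_mem_nhdsWithin
  have hsm : ∀ᶠ ν in 𝓝[>] (0:ℝ), ν < min (min ν₀ ν₁) (min ν₂ 1) :=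
    nhdsWithin_le_nhds (Iio_mem_nhds (by positivity))
  have hKev : ∀ᶠ ν in 𝓝[>] (0:ℝ), a * Real.sqrt ν < min δ Real.pi := by
    have : Tendsto (fun ν : ℝ => a * Real.sqrt ν) (𝓝 (0:ℝ)) (𝓝 (a * Real.sqrt 0)) :=
      (continuous_const.mul Real.continuous_sqrt).tendsto 0
    rw [Real.sqrt_zero, mul_zero] at this
    exact (this.mono_left nhdsWithin_le_nhds).eventually (gt_mem_nhds (lt_min hδ Real.pi_pos))
  have hsand : ∀ᶠ ν in 𝓝[>] (0:ℝ), c₁ ≤ A ν ∧ A ν ≤ |B| / 2 + |M₀| / 2 := by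
    filter_upwards [hpos, hsm, hKev] with ν hν hs hK
    have hs1 : ν < min ν₀ ν₁ := lt_of_lt_of_le hs (min_le_left _ _)
    have hs2 : ν < min ν₂ 1 := lt_of_lt_of_le hs (min_le_right _ _)
    exact ⟨hlow ν hν (hs1.le.trans (min_le_left _ _)) (hs2.le.trans (min_le_left _ _))
        (lt_of_lt_of_le hK (min_le_left _ _)) (hK.le.trans (min_le_right _ _)),
      hup ν hν (hs1.le.trans (min_le_right _ _)) (hs2.le.trans (min_le_right _ _))⟩
  rcases hreg with ⟨L, hL⟩ | htop
  · exact ⟨L, lt_of_lt_of_le hc₁p (ge_of_tendsto hL (hsand.mono fun ν h => h.1)), hL⟩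
  · exfalso
    obtain ⟨ν, h1, h2⟩ := (hsand.and (htop.eventually_ge_atTop (|B| / 2 + |M₀| / 2 + 1))).exists
    linarith [h1.2]

/-- Continuity of an absolutely convergent cosine series with `(1+x²)`-weighted summable coefficients (the `cosSeries` step of
`closes`). [folklore] -/
theorem cosSeries : ∀ c : ℤ → ℝ, Summable (fun x : ℤ => (1 + (x : ℝ) ^ 2) * |c x|) →
    Continuous (fun k : ℝ => ∑' x : ℤ, Real.cos (k * (x : ℝ)) * c x) := fun c hc => by
  refine continuous_tsum (fun x => (Real.continuous_cos.comp (continuous_id.mul continuous_const)).mul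
    continuous_const) (Summable.of_nonneg_of_le (fun x => abs_nonneg _)
      (fun x => le_mul_of_one_le_left (abs_nonneg _) (by nlinarith [sq_nonneg (x : ℝ)])) hc) (fun x k => ?_)
  rw [Real.norm_eq_abs, abs_mul]
  exact mul_le_of_le_one_left (abs_nonneg _) (Real.abs_cos_le_one _)

/-- **The ENGINE of route HoelderEscapeProfile yields a SHIFT-INVARIANT Abelian Green–Kubo witness** (the witness-construction
block of `closes`, verbatim, keeping the shift invariance `hSI` that `closes` drops): for `ω₂, lam, β > 0` (any `γ`) and `T > 0`
there are a shift-invariant DLR Gibbs state `μ_T`, a `μ_T`-preserving dynamics `D` with absolutely convergent correlations and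
`κ > 0` with `T⁻²∫₀^∞e^{−νt}C_T(t)dt → κ` as `ν ↓ 0`. [cite: Helfand1960, eq. (3.10)] -/
theorem regularAbelWitness_of_engine
    (hK1 : LocalEnergyHalfHoelder) (hND : CornerNoDip) (hSC : AbelSpreadCeiling)
    (hAR : AbelRegularity) (hFC : FibreCalculus) (hSet : SymmetricSetup) :
    ∀ ω₂ lam β γ : ℝ, 0 < ω₂ → 0 < lam → 0 < β → ∀ T : ℝ, 0 < T →
      ∃ (μT : Measure ChainConfig) (D : InfiniteChainDynamics (pinnedChain ω₂ lam β γ)) (κ : ℝ),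
        (pinnedChain ω₂ lam β γ).IsChainGibbsMeasure T μT ∧ IsShiftInvariant μT ∧
        D.PreservesMeasure μT ∧ (∀ t : ℝ, D.HasAbsConvergentCorrelation μT t) ∧ 0 < κ ∧
        Tendsto (fun ν : ℝ => (T ^ 2)⁻¹ * ∫ t in Set.Ioi (0:ℝ), Real.exp (-(ν * t)) * D.currentCorrelation μT t)
          (𝓝[>] 0) (𝓝 κ) := by
  intro ω₂ lam β γ hω hl hβ T hT
  set P := Literature.MathematicalPhysics.KineticTheory.HeatConduction.pinnedChain ω₂ lam β γ with hPdef
  obtain ⟨μT, hG, hSI, hRefl, D, hP, hShift⟩ := hSet ω₂ lam β γ hω hl hβ T hT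
  set h : Literature.MathematicalPhysics.KineticTheory.HeatConduction.ChainConfig → ℤ → ℝ :=
    fun σ x => (σ x).2 ^ 2 / 2 + P.U (σ x).1 + (P.V ((σ (x + 1)).1 - (σ x).1) + P.V ((σ x).1 - (σ (x - 1)).1)) / 2 with hh
  set S : ℤ → ℝ → ℝ := fun x t => ∫ σ, (h σ 0 - ∫ σ', h σ' 0 ∂μT) * (h (D.flow t σ) x - ∫ σ', h σ' 0 ∂μT) ∂μT with hS
  set Sb : ℝ → ℤ → ℝ := fun ν x => ν * ∫ t in Set.Ioi (0:ℝ), Real.exp (-(ν * t)) * S x t with hSb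
  set G : ℤ → ℝ → ℝ := fun x t => ∫ σ, P.bondCurrentZ σ 0 * P.bondCurrentZ (D.flow t σ) x ∂μT with hGd
  set Gh : ℝ → ℝ → ℝ := fun ν k => ∫ t in Set.Ioi (0:ℝ), Real.exp (-(ν * t)) * ∑' x : ℤ, Real.cos (k * (x : ℝ)) * G x t
    with hGh
  set fh : ℝ → ℝ → ℝ := fun ν k => ∑' x : ℤ, Real.cos (k * (x : ℝ)) * Sb ν x with hfh
  set χk : ℝ → ℝ := fun k => ∑' x : ℤ, Real.cos (k * (x : ℝ)) * S x 0 with hχk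
  obtain ⟨hAC, hIntC, hIntS, hSumSb, hSumS0, hχpos, hcons, hBoch, hPars, hIntG, hId, hHelf⟩ :=
    hFC ω₂ lam β γ hω hl hβ T hT μT hG hSI hRefl D hP hShift h hh S hS Sb hSb G hGd Gh hGh fh hfh χk hχk
  obtain ⟨C, ν₀, hν₀, hK1'⟩ := hK1 ω₂ lam β γ hω hl hβ T hT μT hG hSI hRefl D hP hShift h hh S hS (hIntS 0)
  obtain ⟨B, ν₁, hν₁, hSC'⟩ := hSC ω₂ lam β γ hω hl hβ T hT μT hG hSI hRefl D hP hShift h hh S hS Sb hSb hIntS hSumSb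
  obtain ⟨κ₀, hκ₀, hAbel⟩ := corner (fun ν => ∫ t in Set.Ioi (0:ℝ), Real.exp (-(ν * t)) * D.currentCorrelation μT t)
    (fun ν => Sb ν 0) (fun ν => ∑' x : ℤ, (x : ℝ) ^ 2 * Sb ν x) χk fh Gh (∑' x : ℤ, (x : ℝ) ^ 2 * S x 0) C ν₀ B ν₁
    hχpos (by rw [hχk]; exact (cosSeries _ hSumS0).continuousAt)
    (fun ν hν => by rw [hfh]; exact cosSeries _ (hSumSb ν hν))
    (fun ν hν => by simp only [hfh, zero_mul, Real.cos_zero, one_mul]; exact hcons ν hν)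
    hBoch hPars hν₀ hK1' hId (fun ν hν => by simp only [hGh, hGd, zero_mul, Real.cos_zero, one_mul]; rfl)
    (hND ω₂ lam β γ hω hl hβ T hT μT hG hSI hRefl D hP hShift G hGd Gh hGh hAC hIntG) hHelf hν₁ hSC'
    (hAR ω₂ lam β γ hω hl hβ T hT μT hG hSI hRefl D hP hShift hAC hIntC)
  exact ⟨μT, D, (T ^ 2)⁻¹ * κ₀, hG, hSI, hP, hAC, mul_pos (by positivity) hκ₀, hAbel.const_mul _⟩

/-- **Bulk Abel floor from the engine**: a positive Abelian limit gives `a = T²κ/2 ≤ ∫₀^∞e^{−νt}C_T` for `ν ∈ (0, ν₀)`, in the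
witness shape consumed by `abelFloor_openChain_of_bulkWitness`. [folklore] -/
theorem bulkAbelFloor_of_engine
    (hK1 : LocalEnergyHalfHoelder) (hND : CornerNoDip) (hSC : AbelSpreadCeiling)
    (hAR : AbelRegularity) (hFC : FibreCalculus) (hSet : SymmetricSetup) :
    ∀ ω₂ lam β γ : ℝ, 0 < ω₂ → 0 < lam → 0 < β → 0 < γ → ∀ T : ℝ, 0 < T →
      ∃ (μT : Measure ChainConfig) (D : InfiniteChainDynamics (pinnedChain ω₂ lam β γ)) (a ν₀ : ℝ),
        (pinnedChain ω₂ lam β γ).IsChainGibbsMeasure T μT ∧ IsShiftInvariant μT ∧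
        D.PreservesMeasure μT ∧ (∀ t : ℝ, D.HasAbsConvergentCorrelation μT t) ∧ 0 < a ∧ 0 < ν₀ ∧
        ∀ ν : ℝ, 0 < ν → ν < ν₀ →
          a ≤ ∫ t in Set.Ioi (0:ℝ), Real.exp (-(ν * t)) * D.currentCorrelation μT t := by
  intro ω₂ lam β γ hω hl hβ _hγ T hT
  obtain ⟨μT, D, κ, hG, hSI, hP, hAC, hκ, hlim⟩ := regularAbelWitness_of_engine hK1 hND hSC hAR hFC hSet ω₂ lam β γ hω hl hβ T hT
  set A : ℝ → ℝ := fun ν => ∫ t in Set.Ioi (0:ℝ), Real.exp (-(ν * t)) * D.currentCorrelation μT t with hAd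
  -- eventually `κ/2 < T⁻² A ν`, hence on some `(0, ν₀)`
  have hev : ∀ᶠ ν in 𝓝[>] (0:ℝ), κ / 2 < (T ^ 2)⁻¹ * A ν := hlim.eventually (lt_mem_nhds (by linarith))
  obtain ⟨ν₀, hν₀, hball⟩ : ∃ ν₀ : ℝ, 0 < ν₀ ∧ ∀ ν : ℝ, 0 < ν → ν < ν₀ → κ / 2 < (T ^ 2)⁻¹ * A ν := by
    rcases (nhdsWithin_hasBasis (Metric.nhds_basis_ball (x := (0:ℝ))) (Ioi (0:ℝ))).eventually_iff.mp hev with ⟨ε, hε, hεs⟩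
    refine ⟨ε, hε, fun ν hν hνε => hεs ⟨?_, hν⟩⟩
    rw [Metric.mem_ball, Real.dist_eq, sub_zero, abs_of_pos hν]
    exact hνε
  have hT2 : 0 < T ^ 2 := by positivity
  refine ⟨μT, D, T ^ 2 * (κ / 2), ν₀, hG, hSI, hP, hAC, by positivity, hν₀, fun ν hν hνlt => ?_⟩
  have h1 := hball ν hν hνlt
  have h2 : T ^ 2 * ((T ^ 2)⁻¹ * A ν) = A ν := by field_simp
  calc T ^ 2 * (κ / 2) ≤ T ^ 2 * ((T ^ 2)⁻¹ * A ν) := mul_le_mul_of_nonneg_left h1.le hT2.le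
    _ = A ν := h2

/-- **`HoelderEscapeProfile.ConductanceLowerBound` from the route's ENGINE and the sibling (R).**  On the bet route the split child
CLB = stmt-11749 of `AbelThermodynamicLimit` follows from `LocalEnergyHalfHoelder`, `CornerNoDip`, `AbelSpreadCeiling`,
`AbelRegularity`, `FibreCalculus`, `SymmetricSetup` and `UniformAbelianRegularity` (stmt-13416; only its lower half is used), by
the landed bridges of line `abel-floor-exchange` (bulk floor ⇒ open-chain Abel floor at fixed frequency; (R) ⇒ (R⁻); Kubo identity +
Abelian split). [cite: KunduDharNarayan2009, p. 3] -/
theorem conductanceLowerBound_of_engine : Summit.AtomisticToContinuum.FouriersLaw.Theses.HoelderEscapeProfile.LocalEnergyHalfHoelder → Summit.AtomisticToContinuum.FouriersLaw.Theses.HoelderEscapeProfile.CornerNoDip → Summit.AtomisticToContinuum.FouriersLaw.Theses.HoelderEscapeProfile.AbelSpreadCeiling → Summit.AtomisticToContinuum.FouriersLaw.Theses.HoelderEscapeProfile.AbelRegularity → Summit.AtomisticToContinuum.FouriersLaw.Theses.HoelderEscapeProfile.FibreCalculus → Summit.AtomisticToContinuum.FouriersLaw.Theses.HoelderEscapeProfile.SymmetricSetup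 → Summit.AtomisticToContinuum.FouriersLaw.Theses.HoelderEscapeProfile.UniformAbelianRegularity → Summit.AtomisticToContinuum.FouriersLaw.Theses.HoelderEscapeProfile.ConductanceLowerBound :=
  fun hK1 hND hSC hAR hFC hSet hR =>
  Summit.AtomisticToContinuum.FouriersLaw.Cruxes.ConductanceLowerBound.AbelFloorExchange.conductanceLowerBound_of_abelFloor_and_signedSlowRegularity
    (Summit.AtomisticToContinuum.FouriersLaw.Cruxes.ConductanceLowerBound.AbelFloorExchange.abelFloor_openChain_of_bulkWitness
      (bulkAbelFloor_of_engine hK1 hND hSC hAR hFC hSet))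
    (Summit.AtomisticToContinuum.FouriersLaw.Cruxes.ConductanceLowerBound.AbelFloorExchange.slowRegularity_signed_of_uniformAbelianRegularity hR)

/-- **The crux from the engine and (R)** (split glue p127832 `stub_cruxOfRegularityOfLowerBound` applied to (R) and the engine's
CLB): on route HoelderEscapeProfile, `AbelThermodynamicLimit` (stmt-12596) follows from the six engine/frame cruxes and
`UniformAbelianRegularity` (stmt-13416) alone. [folklore] -/
theorem abelThermodynamicLimit_of_engine_and_regularity
    (hK1 : LocalEnergyHalfHoelder) (hND : CornerNoDip) (hSC : AbelSpreadCeiling)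
    (hAR : AbelRegularity) (hFC : FibreCalculus) (hSet : SymmetricSetup)
    (hR : UniformAbelianRegularity) : AbelThermodynamicLimit :=
  AbelThermodynamicLimitGlueBy_holds hR (conductanceLowerBound_of_engine hK1 hND hSC hAR hFC hSet hR)

/-- **`FouriersLaw` from the engine and (R)** (through the route's own deciding theorem `closes`): on the bet route
HoelderEscapeProfile the honest open cone under the node `AbelThermodynamicLimit` is {stmt-13416} — the child CLB (stmt-11749) and
the γ-blind hypothesis witness of the crux are both supplied by the engine. [cite: BonettoLebowitzReyBellet2000, §5.3 eq. (33)] -/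
theorem fouriersLaw_of_engine_and_regularity
    (hK1 : LocalEnergyHalfHoelder) (hND : CornerNoDip) (hSC : AbelSpreadCeiling)
    (hAR : AbelRegularity) (hFC : FibreCalculus) (hSet : SymmetricSetup)
    (hR : UniformAbelianRegularity) : _root_.FouriersLaw :=
  closes hK1 hND hSC hAR (abelThermodynamicLimit_of_engine_and_regularity hK1 hND hSC hAR hFC hSet hR) hFC hSet

end Summit.AtomisticToContinuum.FouriersLaw.Theorems.AbelThermodynamicLimit.HoelderEngine

end
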